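import Mathlib
import Summits.ValiantsHypothesis.ValiantsHypothesis.Theses.FermionizationDimension

/-!
# Route FermionizationDimension — item `NoScalarTwist` (stmt-ValiantsHypothesis-7291)

Pólya–Szegő (1913) / Marcus–Minc (1961), Brualdi–Ryser Thm 7.5.1: for `n ≥ 3` there is no complex
matrix `u` with `∏ i, u (σ i) i = sgn σ` for every permutation `σ`, i.e. the sign character is not a
"scalar Hadamard twist" of the all-ones pattern (`s(n) ≥ 2` in the route's language).

Proof (the classical `3 × 3` argument, after fixing `n - 3` points). Pick three distinct indices
`a b c` and let `R = ∏_{i ∉ {a,b,c}} u i i`. For a permutation `σ` fixing every index outside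
`{a,b,c}` one has `∏ i, u (σ i) i = u (σ a) a * u (σ b) b * u (σ c) c * R`
(`prod_twist_eq_of_fixes`). Evaluating at the identity, the three transpositions and the two
`3`-cycles on `{a,b,c}` gives six equations; the product of the three "even" left-hand sides equals
the product of the three "odd" ones (each entry `u x y`, `x y ∈ {a,b,c}`, occurs exactly once in
each, and `R` thrice), whence `1 = -1` in `ℂ`.
-/

set_option linter.dupNamespace false -- single-conjunct summit: `ValiantsHypothesis.ValiantsHypothesis`

namespace Summit.ValiantsHypothesis.ValiantsHypothesis.Theorems

open Equiv

/-- If `σ` fixes every index outside `S`, the twisted transversal product `∏ i, u (σ i) i` splits as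
the part over `S` times the diagonal product over `Sᶜ`. [folklore] -/
theorem prod_twist_eq_of_fixes {ι : Type*} [Fintype ι] [DecidableEq ι] (u : ι → ι → ℂ)
    (S : Finset ι) (σ : Perm ι) (hσ : ∀ i, i ∉ S → σ i = i) :
    ∏ i, u (σ i) i = (∏ i ∈ S, u (σ i) i) * ∏ i ∈ Sᶜ, u i i := by
  rw [← Finset.prod_mul_prod_compl S (fun i => u (σ i) i)]
  congr 1
  exact Finset.prod_congr rfl (fun i hi => by rw [hσ i (Finset.mem_compl.mp hi)])

/-- **Pólya–Szegő / Marcus–Minc, core `3 × 3` step.** On a finite index type with three distinct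
elements `a b c`, no `u : ι → ι → ℂ` satisfies `∏ i, u (σ i) i = sgn σ` for all permutations `σ`:
the identity, the three transpositions and the two `3`-cycles on `{a,b,c}` give `1 = -1`.
[cite: BrualdiRyser1991, Thm 7.5.1] -/
theorem no_sign_twist_of_three_distinct {ι : Type*} [Fintype ι] [DecidableEq ι] (u : ι → ι → ℂ)
    {a b c : ι} (hab : a ≠ b) (hbc : b ≠ c) (hac : a ≠ c)
    (hu : ∀ σ : Perm ι, ∏ i, u (σ i) i = ((Perm.sign σ : ℤ) : ℂ)) : False := by
  set S : Finset ι := {a, b, c} with hS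
  set R : ℂ := ∏ i ∈ Sᶜ, u i i with hR
  -- the uniform evaluation of a permutation supported on `{a,b,c}`
  have key : ∀ σ : Perm ι, (∀ i, i ∉ S → σ i = i) →
      u (σ a) a * u (σ b) b * u (σ c) c * R = ((Perm.sign σ : ℤ) : ℂ) := by
    intro σ hσ
    rw [← hu σ, prod_twist_eq_of_fixes u S σ hσ, hS,
      Finset.prod_insert (by simp [hab, hac]), Finset.prod_insert (by simp [hbc]),
      Finset.prod_singleton]
    ring
  have ha : a ∈ S := by simp [hS]
  have hb : b ∈ S := by simp [hS]
  have hc : c ∈ S := by simp [hS]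
  have fix1 : ∀ i, i ∉ S → (1 : Perm ι) i = i := fun i _ => rfl
  have fixsw : ∀ x y, x ∈ S → y ∈ S → ∀ i, i ∉ S → swap x y i = i := by
    intro x y hx hy i hi
    apply swap_apply_of_ne_of_ne
    · rintro rfl; exact hi hx
    · rintro rfl; exact hi hy
  have fixmul : ∀ σ τ : Perm ι, (∀ i, i ∉ S → σ i = i) → (∀ i, i ∉ S → τ i = i) →
      ∀ i, i ∉ S → (σ * τ) i = i := by
    intro σ τ hσ hτ i hi
    rw [Perm.mul_apply, hτ i hi, hσ i hi]
  have h1 := key 1 fix1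
  have h2 := key (swap a b) (fixsw a b ha hb)
  have h3 := key (swap b c) (fixsw b c hb hc)
  have h4 := key (swap a c) (fixsw a c ha hc)
  have h5 := key (swap a b * swap b c) (fixmul _ _ (fixsw a b ha hb) (fixsw b c hb hc))
  have h6 := key (swap b c * swap a b) (fixmul _ _ (fixsw b c hb hc) (fixsw a b ha hb))
  simp only [Perm.one_apply, Perm.mul_apply, swap_apply_left, swap_apply_right,
    swap_apply_of_ne_of_ne hab hac, swap_apply_of_ne_of_ne hab.symm hbc,
    swap_apply_of_ne_of_ne hac.symm hbc.symm,
    Perm.sign_one, Perm.sign_mul, Perm.sign_swap hab, Perm.sign_swap hbc, Perm.sign_swap hac,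
    Units.val_one, Units.val_neg, Int.cast_one, Int.cast_neg, mul_neg, mul_one, neg_neg]
    at h1 h2 h3 h4 h5 h6
  -- `BCD - AEF = 0` identically (A…F the six left-hand sides), written linearly in `h1 … h6`
  have h : (1 : ℂ) = -1 := by
    linear_combination (u a a * u c b * u b c * R) * (u c a * u b b * u a c * R) * h2
      - (u c a * u b b * u a c * R) * h3 + h4
      - (u b a * u c b * u a c * R) * (u c a * u a b * u b c * R) * h1
      - (u c a * u a b * u b c * R) * h5 - h6
  norm_num at h

/-- **Item `NoScalarTwist` (Pólya–Szegő 1913 / Marcus–Minc 1961; Brualdi–Ryser Thm 7.5.1).**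
For `n ≥ 3` no complex matrix `u : Fin n → Fin n → ℂ` has `∏ i, u (σ i) i = sgn σ` for every
`σ ∈ S_n`; equivalently the commutative twisting dimension of the permanent is at least `2`.
Proof: apply `no_sign_twist_of_three_distinct` to the images of `0, 1, 2 : Fin 3` under
`Fin.castLE`. [cite: BrualdiRyser1991, Thm 7.5.1] -/
theorem noScalarTwist_proof :
    Summit.ValiantsHypothesis.ValiantsHypothesis.Theses.FermionizationDimension.NoScalarTwist := by
  unfold Summit.ValiantsHypothesis.ValiantsHypothesis.Theses.FermionizationDimension.NoScalarTwist
  intro n hn ⟨u, hu⟩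
  exact no_sign_twist_of_three_distinct u (a := Fin.castLE hn 0) (b := Fin.castLE hn 1)
    (c := Fin.castLE hn 2) ((Fin.castLE_injective hn).ne (by decide))
    ((Fin.castLE_injective hn).ne (by decide)) ((Fin.castLE_injective hn).ne (by decide)) hu

end Summit.ValiantsHypothesis.ValiantsHypothesis.Theorems
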